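import Mathlib
import Summits.KontsevichZagierPeriods.Zeta5Search.ClusterValuationPairs
import Summits.KontsevichZagierPeriods.Zeta5Search.PalindromicVDigits
import Summits.KontsevichZagierPeriods.Zeta5Search.ConstantTermFloorWindow
import Summits.KontsevichZagierPeriods.Zeta5Search.CasoratianClassBoundProof
import Summits.KontsevichZagierPeriods.Zeta5Search.MixedPairTermwiseProof
import HarnessLib

/-!
# ζ(5) search — DENOM-LAW track D3 (denom-theory-d3 g4): the CLASS-ORBIT BOUND — statements, and the proofs of COB and of the orbit floor

Filed into the tree by the prover seat denom-engine-d2 g4 for the planner seat denom-theory-d3 g4 (author; seat file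
`HOME/denom-law/code/d3g4/lean/OrbitCredit.lean` v2, sha256 968d4ff9…, `lean check` rc 0 / 0 sorries), split into two files ≤ 400 lines:
this file = definitions + `classOrbitBound_holds` + `orbitFloor_holds`; `DenomLaw/OrbitCreditCasoratian.lean` = the shift monotonicity of
`ν⁺` and `casoratianOrbitBound_holds`.  The decidable spot checks of the seat file (record ray n = 2 etc., `native_decide`) are not filed.
Cell `pub-zeta5` (HONEST FRAMING: systematic search; `p`-adic valuation bounds on the rational numbers `V(b)`, `Cas_j(b)`;
`lean check` rc 0, 0 sorries, audit `closed: true` for the three `_holds` theorems IN THIS SEAT FILE — they become tree theorems only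
when a prover seat files them; the EXACTNESS rates quoted are MODEL-side data; no γ moves; no irrationality claim; records in print UNMOVED).

The Rhin–Viola lens at level 5, as far as the data let it act: the only symmetry of `R_b` beyond relabelling is the
WELL-POISED REFLECTION `y ↦ −y − b₀` (`R_b` is odd under it), which permutes the residue classes mod `p`:
`x ↦ x̄ = conjClass b p x`.  Its ORBITS (conjugate pairs of classes) carry a `p`-adic credit:

* IN THE TREE ALREADY (typer gen 9, all PROVED): `UniversalDigitDischarge.gHatConj_holds` (`ĝ_{b₀−q} = (−1)^{E_x+1} ĝ_q`, centre-free
  classes), `CHatReversalProof.classRho_conj` (`ρ_{b₀−q,σ} = (−1)^{E_x+σ} ρ_{q,σ}`), `UniversalDigitDischarge.vDigit_holds` (the `p^{E_x}`-digit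
  of `V_x` is `ĝ_q·v̂_x`), and the PAIR LEMMA `PalindromicVDigits.padicNorm_classV_pair_le`: for a centre-free pole class whose net exponents
  are palindromic along the class frame (`netExp s = netExp (T + x − s)`, `T` the top point) and whose exponent `E_x` is EVEN,
  **`v_p(V_x + V_x̄) ≥ E_x + 1`**.  (This seat re-derived the lemma from data before finding it in the tree: 10,770 credited pairs, 0 with
  gain < 1 (d3g4 `test_beta.py`); E-odd palindromic pairs gain nothing in 651/655 and non-palindromic pairs in 42,838/43,363 — sporadic digit
  zeros, rate ~ 1/p; exact re-check incl. tame classes `test_r1_beta_all.py`: 9,240 pairs, 0 failures; `ĝ` reflection 108,555 positions, 0.)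
  The tree uses the pair lemma only inside the EXTREMAL regimes of `DoubleDropBonus` / `PalindromicVCarrierBonus`; the point of this file
  is the GLOBAL digit-free minimum below, over ALL pole classes, and its corollaries.
* `ClassOrbitBound` (COB) — **PROVED here, `classOrbitBound_holds`**, by ASSEMBLY of tree theorems: `coeffV_eq_sum_classV`, the doubling
  `2V = Σ_x (V_x + V_x̄)` along the involution `conjClass` (`conjClass_conjClass`, `conjClass_lt`), `CasoratianClassBoundShift.padicNorm_classV_le`
  (= `classNuBound_holds`) on the uncredited classes and `padicNorm_classV_pair_le` on the credited orbits `{x, x̄}`: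
  `v_p(V(b)) ≥ VB⁺(b,p)`, `VB⁺ = min_x (ν_x + credit_x)`, window `5 ≤ p ≤ b₀ < p² − 2`; norm form `padicNorm_coeffV_le_plus`.
  DATA (MODEL-side): retro-diction 382,822 kernel cells, 0 violations, equality 96.1 % (vs 75.3 % for `vbMin`); sealed out-of-sample
  exactness test `denom-law/prereg/PREREG-D3-COB.json` (the BOUND half of its claim C1 is now a theorem of this file; exactness stays a test).
* `OrbitFloor` — **PROVED here, `orbitFloor_holds`**: `VB⁺ ≥ −N_p` (extremal classes are credited by `classExpRigidity_holds`; all other pole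
  classes have `ν_x ≥ −N_p` by `ConstantTermFloorWindow.neg_pairFloors_le_classNu`).  With COB this re-derives THEOREM V
  (`constantTermFloorLaw_window`, already in the tree) through `VB⁺`.
* `CasoratianOrbitBound` — **PROVED in `DenomLaw/OrbitCreditCasoratian.lean`, `casoratianOrbitBound_holds`**: `v_p(Cas_j(b)) ≥ LB⁺(b,p) := VB⁺ + rowMin` for `1 ≤ j ≤ 7`,
  `b, b + e_j` in the polytope, `5 ≤ p ≤ b₀ < p² − 2` — THEOREM LB (`casoratianClassBound_holds`) with the orbit credit; the new input is
  `classNuPlus_shift_ge` (`ν⁺` is monotone under `b ↦ b + e_j`: an unhit credited class keeps its credit — `netExp_shift_eq_of_classExp_eq` —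
  and a hit one gains a unit of exponent).
* `OrbitFloorH` (CONJECTURED, DIGIT-FREE counting statement, the one item of this file left open): `VB⁺ ≥ −N_p + 1` under `⌊d/p⌋ = 1`,
  first period and LoopAndPair — with COB it gives the H* unit (VH) of SYMMETRY-D3 §8.6–8.9 (20,947 corpus H-cells, 0 exceptions;
  `OrbitFloor` itself: 431,999 cells, 0 exceptions, now a theorem).
-/

open Finset
open Summit.KontsevichZagierPeriods.Zeta5Search.WedgeDictionary (coeffV pfData dOf)
open Summit.KontsevichZagierPeriods.Zeta5Search.CasoratianValuation (InPolytope pairFloors shift casoratian)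

namespace Summit.KontsevichZagierPeriods.Zeta5Search.ClusterValuation.Orbit

open Summit.KontsevichZagierPeriods.Zeta5Search.ClusterValuation
open Summit.KontsevichZagierPeriods.Zeta5Search.PadicSeries (one_le_p zpow_p_nonneg)
open Summit.KontsevichZagierPeriods.Zeta5Search.DualSeries (InBox)
open Summit.KontsevichZagierPeriods.Zeta5Search.BigPrime (shift_zero dOf_shift)

/-- The top element of the class of `x < p`: `x + p·⌊(b₀ − x)/p⌋`. -/
def classTop (b : ℕ → ℤ) (p x : ℕ) : ℕ := x + p * (((b 0).toNat - x) / p)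

/-- FRAME-PALINDROMIC class: the net exponents along the class frame `x, x+p, …, classTop` read the same backwards
(equivalently: the class of `x` and its conjugate class have the same net vector in increasing order).  Written literally as the
hypothesis `hpal` of `PalindromicVDigits.padicNorm_classV_pair_le` (`b₀ − (b₀ − x) % p = classTop`, and `T − (s − x) = T + x − s` on the class). -/
def FramePalindromic (b : ℕ → ℤ) (p x : ℕ) : Prop :=
  ∀ s ∈ classSet b p x, netExp b s = netExp b ((b 0).toNat - ((b 0).toNat - x) % p - (s - x))

/-- `FramePalindromic` is decidable (a finite conjunction over the class). -/
instance (b : ℕ → ℤ) (p x : ℕ) : Decidable (FramePalindromic b p x) := by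
  unfold FramePalindromic; infer_instance

/-- The ORBIT CREDIT of a pole class: `1` for a non-tame, centre-free, frame-palindromic class with even class exponent, else `0`.
(`¬ CentreIn` is implied by `Even E_x` — a self-conjugate class has odd exponent — and is kept explicit so that a credited class meets the
hypotheses of `padicNorm_classV_pair_le` literally; the sealed Python words `coblaw.py` omit it, same values.) -/
def orbitCredit (b : ℕ → ℤ) (p x : ℕ) : ℤ :=
  if ¬ (classPoleCount b p x = 1 ∧ tameSingle b p x = true) ∧ ¬ CentreIn b p x ∧ FramePalindromic b p x ∧ Even (classExp b p x) then 1 else 0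

/-- `ν⁺_x = ν_x + credit_x`. -/
def classNuPlus (b : ℕ → ℤ) (p x : ℕ) : ℤ := classNu b p x + orbitCredit b p x

/-- `VB⁺(b,p)`: the minimum of `ν⁺_x` over the pole classes (`none` if there is no pole class). -/
def vbPlus (b : ℕ → ℤ) (p : ℕ) : Option ℤ :=
  (((List.range p).filter fun x => 1 ≤ classPoleCount b p x).map (classNuPlus b p)).min?

/-- `m₁(b) = max(max_j b_j, max_{j<k} (b₀ − b_j − b_k))`: the largest factorial argument; FIRST PERIOD means `m₁ < 2p`. -/
def mOne (b : ℕ → ℤ) : ℤ :=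
  max ((Finset.Icc 1 7).sup' (by decide) fun j => b j)
      (((Finset.Icc 1 7) ×ˢ (Finset.Icc 1 7)).sup' (by decide) fun jk => if jk.1 < jk.2 then b 0 - b jk.1 - b jk.2 else b 1)

/-- LoopAndPair (the `H` predicate of the H* unit): some vertex `j` with `b_j ≥ p` and `b₀ − b_j − b_k ≥ p` for every `k ≠ j`. -/
def HasLoopAndPair (b : ℕ → ℤ) (p : ℕ) : Prop :=
  ∃ j, 1 ≤ j ∧ j ≤ 7 ∧ (p : ℤ) ≤ b j ∧ ∀ k, 1 ≤ k → k ≤ 7 → k ≠ j → (p : ℤ) ≤ b 0 - b j - b k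

/-! `FramePalindromic b p x` is the hypothesis `hpal` of `padicNorm_classV_pair_le` with `T = classTop b p x`
(`(b 0).toNat − ((b 0).toNat − x) % p = x + p·(((b 0).toNat − x)/p)` for `x < p ≤ b₀`). -/

/-- **THE CLASS-ORBIT BOUND (COB; PROVED below, `classOrbitBound_holds`; tagged `@[conjecture]` only so that the audit registers the
proof-of-item edge)**: `v_p(V(b)) ≥ VB⁺(b,p)` in the window `5 ≤ p ≤ b₀ < p² − 2`. -/
@[conjecture] def ClassOrbitBound : Prop :=
  ∀ (b : ℕ → ℤ) (p : ℕ) (v : ℤ), InPolytope b → p.Prime → 5 ≤ p → (p : ℤ) ≤ b 0 → (b 0 + 2 : ℤ) < (p : ℤ) ^ 2 →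
    vbPlus b p = some v → coeffV b ≠ 0 → v ≤ padicValRat p (coeffV b)

/-- **ORBIT FLOOR (digit-free; PROVED below as `orbitFloor_holds` from `classExpRigidity_holds` + `neg_pairFloors_le_classNu`)**:
`VB⁺ ≥ −N_p` for every window prime. -/
@[conjecture] def OrbitFloor : Prop :=
  ∀ (b : ℕ → ℤ) (p : ℕ) (v : ℤ), InPolytope b → p.Prime → 5 ≤ p → (p : ℤ) ≤ b 0 → (b 0 + 2 : ℤ) < (p : ℤ) ^ 2 →
    vbPlus b p = some v → -pairFloors b p ≤ v

/-- **ORBIT FLOOR UNDER H (CONJECTURED, digit-free; with `ClassOrbitBound` it gives the H* unit (VH))**: in the first period of the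
one-carry regime, LoopAndPair lifts the orbit floor by one. -/
@[conjecture] def OrbitFloorH : Prop :=
  ∀ (b : ℕ → ℤ) (p : ℕ) (v : ℤ), InPolytope b → p.Prime → 5 ≤ p → (p : ℤ) ≤ b 0 → (b 0 + 2 : ℤ) < (p : ℤ) ^ 2 →
    (p : ℤ) ≤ dOf b → dOf b < 2 * (p : ℤ) → mOne b < 2 * (p : ℤ) → HasLoopAndPair b p →
      vbPlus b p = some v → -pairFloors b p + 1 ≤ v

/-- `LB⁺(b,p) = VB⁺ + rowMin` (`0` when undefined): the tree's digit-free Casoratian class bound `casLB` with `vbMin ↦ vbPlus`. -/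
def casLBPlus (b : ℕ → ℤ) (p : ℕ) : ℤ :=
  match vbPlus b p, rowMin b p with
  | some v, some r => v + r
  | _, _ => 0

/-- **CASORATIAN ORBIT BOUND (PROVED in `DenomLaw/OrbitCreditCasoratian.lean`, `casoratianOrbitBound_holds`; `CasoratianClassBound` with the orbit credit)**:
`v_p(Cas_j(b)) ≥ LB⁺(b,p)` for `5 ≤ p ≤ b₀ < p² − 2`.  DATA (MODEL-side, j = 7 only, via `v_p(P_n) = v_p(ρ) + v_p(Cas_7)` on the 21,458
large-prime census ts6 cells): 0 violations (now implied); as a denominator prediction `min(L_PATH, −v_p(ρ) − LB⁺)` it is exact on 21,249 cells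
(L_PATH alone: 20,981), coinciding cell by cell with `min(L_PATH, E_COB)`. -/
@[conjecture] def CasoratianOrbitBound : Prop :=
  ∀ (b : ℕ → ℤ) (j p : ℕ), InPolytope b → 1 ≤ j → j ≤ 7 → InPolytope (shift b j) →
    p.Prime → 5 ≤ p → (p : ℤ) ≤ b 0 → (b 0 + 2 : ℤ) < (p : ℤ) ^ 2 → casoratian b j ≠ 0 → casLBPlus b p ≤ padicValRat p (casoratian b j)


/-! ### COB is a theorem: assembly of `classNuBound_holds` and `padicNorm_classV_pair_le` over reflection orbits -/

/-- The credit condition (the `if` of `orbitCredit`). -/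
def Credited (b : ℕ → ℤ) (p x : ℕ) : Prop :=
  ¬ (classPoleCount b p x = 1 ∧ tameSingle b p x = true) ∧ ¬ CentreIn b p x ∧ FramePalindromic b p x ∧ Even (classExp b p x)

/-- `Credited` is decidable. -/
instance (b : ℕ → ℤ) (p x : ℕ) : Decidable (Credited b p x) := by
  unfold Credited; infer_instance

/-- `orbitCredit` is the indicator of `Credited`. -/
theorem orbitCredit_eq (b : ℕ → ℤ) (p x : ℕ) : orbitCredit b p x = if Credited b p x then 1 else 0 := rfl

/-- `vbPlus = some v` bounds `v` by every pole class's `ν⁺_x`. -/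
theorem le_classNuPlus_of_vbPlus (b : ℕ → ℤ) {p : ℕ} {v : ℤ} (hv : vbPlus b p = some v) {y : ℕ} (hy : y < p)
    (hpole : 1 ≤ classPoleCount b p y) : v ≤ classNuPlus b p y := by
  unfold vbPlus at hv
  have hmem : classNuPlus b p y ∈ ((List.range p).filter fun x => 1 ≤ classPoleCount b p x).map (classNuPlus b p) :=
    List.mem_map.2 ⟨y, List.mem_filter.2 ⟨List.mem_range.2 hy, by simpa using hpole⟩, rfl⟩
  exact (List.min?_eq_some_iff.1 hv).2 _ hmem

/-- A credited pole class and its conjugate: `‖V_x + V_x̄‖_p ≤ p^{−ν⁺_x}` (the pair lemma of `PalindromicVDigits`). -/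
theorem padicNorm_pair_le_of_credited (b : ℕ → ℤ) {p : ℕ} [hp : Fact p.Prime] (hb : InPolytope b) (hp5 : 5 ≤ p)
    (hpn : p ≤ (b 0).toNat) (hwin : (b 0 + 2 : ℤ) < (p : ℤ) ^ 2) {x : ℕ} (hx : x < p) (hpole : 1 ≤ classPoleCount b p x)
    (hC : Credited b p x) :
    padicNorm p (classV b p x + classV b p (conjClass b p x)) ≤ (p : ℚ) ^ (-classNuPlus b p x) := by
  have hcr : orbitCredit b p x = 1 := by rw [orbitCredit_eq, if_pos hC]
  have hn : classNu b p x = classExp b p x := by unfold classNu; rw [if_neg hC.1]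
  have hnu : classNuPlus b p x = classExp b p x + 1 := by unfold classNuPlus; rw [hcr, hn]
  rw [hnu]
  exact padicNorm_classV_pair_le b hb hp5 hpn hwin hx hpole hC.2.1 hC.2.2.1 hC.2.2.2

/-- An uncredited pole class: `‖V_x‖_p ≤ p^{−ν⁺_x}` (`classNuBound_holds`). -/
theorem padicNorm_le_of_uncredited (b : ℕ → ℤ) {p : ℕ} [hp : Fact p.Prime] (hb : InPolytope b) (hp5 : 5 ≤ p)
    (hwin : (b 0 + 2 : ℤ) < (p : ℤ) ^ 2) {x : ℕ} (hx : x < p) (hpole : 1 ≤ classPoleCount b p x) (hC : ¬ Credited b p x) :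
    padicNorm p (classV b p x) ≤ (p : ℚ) ^ (-classNuPlus b p x) := by
  have hnu : classNuPlus b p x = classNu b p x := by
    unfold classNuPlus; rw [orbitCredit_eq, if_neg hC, add_zero]
  rw [hnu]
  exact padicNorm_classV_le b hb hp5 hwin hx hpole

/-- **The norm form of COB**: if `v ≤ ν⁺_y` for every pole class `y` then `‖V(b)‖_p ≤ p^{−v}` — `V = Σ_x V_x`, `2V = Σ_x (V_x + V_x̄)`
(`x ↦ x̄` is an involution of the residues), each pair bounded by the pair lemma when one member is credited and termwise otherwise;
`‖2‖_p = 1`.  (The `ν⁺`-analogue of the tree's `padicNorm_coeffV_le`.) -/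
theorem padicNorm_coeffV_le_plus (b : ℕ → ℤ) {p : ℕ} [hp : Fact p.Prime] (hb : InPolytope b) (hp5 : 5 ≤ p)
    (hpb : (p : ℤ) ≤ b 0) (hwin : (b 0 + 2 : ℤ) < (p : ℤ) ^ 2) (v : ℤ)
    (hvle : ∀ y, y < p → 1 ≤ classPoleCount b p y → v ≤ classNuPlus b p y) :
    padicNorm p (coeffV b) ≤ (p : ℚ) ^ (-v) := by
  have hprime := hp.out
  have h0 : 0 ≤ b 0 := hb.1.1
  have hb0 : (((b 0).toNat : ℕ) : ℤ) = b 0 := Int.toNat_of_nonneg h0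
  have hp0 : 0 < p := hprime.pos
  have hpn : p ≤ (b 0).toNat := by omega
  rw [coeffV_eq_sum_classV b hp0]
  -- double the class sum along the involution `x ↦ x̄`
  have hmaps : ∀ x ∈ range p, conjClass b p x ∈ range p := fun x _ => mem_range.2 (conjClass_lt b hp0 x)
  have hinv : ∀ x ∈ range p, conjClass b p (conjClass b p x) = x := fun x hx =>
    conjClass_conjClass b (mem_range.1 hx) hpn
  have hpair : ∑ x ∈ range p, classV b p (conjClass b p x) = ∑ x ∈ range p, classV b p x :=
    sum_nbij' (conjClass b p) (conjClass b p) hmaps hmaps hinv hinv (fun _ _ => rfl)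
  have h2 : (2 : ℚ) * ∑ x ∈ range p, classV b p x = ∑ x ∈ range p, (classV b p x + classV b p (conjClass b p x)) := by
    rw [sum_add_distrib, hpair, two_mul]
  have hn2 : padicNorm p (2 : ℚ) = 1 := by
    have := (padicNorm.nat_eq_one_iff (p := p) 2).2 (by
      intro h; have := (Nat.prime_dvd_prime_iff_eq hprime Nat.prime_two).1 h; omega)
    exact_mod_cast this
  calc padicNorm p (∑ x ∈ range p, classV b p x)
      = padicNorm p ((2 : ℚ) * ∑ x ∈ range p, classV b p x) := by rw [padicNorm.mul, hn2, one_mul]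
    _ = padicNorm p (∑ x ∈ range p, (classV b p x + classV b p (conjClass b p x))) := by rw [h2]
    _ ≤ (p : ℚ) ^ (-v) := by
      refine padicNorm.sum_le' (fun x hx => ?_) (zpow_p_nonneg _)
      have hx' := mem_range.1 hx
      have hxc : conjClass b p x < p := conjClass_lt b hp0 x
      have hcc : classPoleCount b p (conjClass b p x) = classPoleCount b p x := classPoleCount_conj b h0 (by omega)
      rcases Nat.eq_zero_or_pos (classPoleCount b p x) with hc0 | hcpos
      · -- no poles in the class, none in its conjugate
        rw [classV_eq_zero_of_noPole b hb hc0, classV_eq_zero_of_noPole b hb (by rw [hcc, hc0]), add_zero, padicNorm.zero]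
        exact zpow_p_nonneg _
      · have hcpos' : 1 ≤ classPoleCount b p (conjClass b p x) := by rw [hcc]; exact hcpos
        by_cases hC : Credited b p x
        · exact (padicNorm_pair_le_of_credited b hb hp5 hpn hwin hx' hcpos hC).trans
            (zpow_le_zpow_right₀ one_le_p (by linarith [hvle x hx' hcpos]))
        · by_cases hC' : Credited b p (conjClass b p x)
          · have h := padicNorm_pair_le_of_credited b hb hp5 hpn hwin hxc hcpos' hC'
            rw [hinv x hx, add_comm] at h
            exact h.trans (zpow_le_zpow_right₀ one_le_p (by linarith [hvle _ hxc hcpos']))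
          · refine (padicNorm.nonarchimedean (p := p)).trans (max_le ?_ ?_)
            · exact (padicNorm_le_of_uncredited b hb hp5 hwin hx' hcpos hC).trans
                (zpow_le_zpow_right₀ one_le_p (by linarith [hvle x hx' hcpos]))
            · exact (padicNorm_le_of_uncredited b hb hp5 hwin hxc hcpos' hC').trans
                (zpow_le_zpow_right₀ one_le_p (by linarith [hvle _ hxc hcpos']))

/-- **COB holds**: `v_p(V(b)) ≥ VB⁺(b,p)` for `5 ≤ p ≤ b₀ < p² − 2`. -/
theorem classOrbitBound_holds : ClassOrbitBound := by
  intro b p v hb hprime hp5 hpb hwin hv hV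
  haveI : Fact p.Prime := ⟨hprime⟩
  have hp1 : (1 : ℚ) < p := by exact_mod_cast hprime.one_lt
  have hnorm := padicNorm_coeffV_le_plus b hb hp5 hpb hwin v fun y hy hpole => le_classNuPlus_of_vbPlus b hv hy hpole
  rw [padicNorm.eq_zpow_of_nonzero hV] at hnorm
  have := (zpow_le_zpow_iff_right₀ hp1).1 hnorm
  linarith


/-! ### The orbit floor is a theorem: extremal classes are credited (`ClassExpRigidity`), all others have `ν_x ≥ −N_p` -/

/-- A class containing the centre is self-conjugate. -/
theorem conjClass_eq_self_of_centreIn (b : ℕ → ℤ) (h0 : 0 ≤ b 0) {p x : ℕ} (hx : x < p) (hxn : x ≤ (b 0).toNat)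
    (hc : CentreIn b p x) : conjClass b p x = x := by
  unfold conjClass
  unfold CentreIn at hc
  have hb0 : (((b 0).toNat : ℕ) : ℤ) = b 0 := Int.toNat_of_nonneg h0
  have h1 : (((b 0).toNat - x : ℕ) : ℤ) % (p : ℤ) = (x : ℤ) % (p : ℤ) := by
    have hdvd : (p : ℤ) ∣ (x : ℤ) - (((b 0).toNat - x : ℕ) : ℤ) := by
      have e : (x : ℤ) - (((b 0).toNat - x : ℕ) : ℤ) = 2 * (x : ℤ) - b 0 := by push_cast [Nat.cast_sub hxn]; omega
      rw [e]; exact hc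
    exact Int.modEq_iff_dvd.2 hdvd
  have h2 : (((b 0).toNat - x) % p : ℕ) = x % p := by exact_mod_cast h1
  rw [h2, Nat.mod_eq_of_lt hx]

/-- **Extremal classes are credited**: `E_x = −(N_p+1)` with two poles forces shape `(−1,−1)` or `(−2,−2)` (`classExpRigidity_holds`),
hence a non-tame, centre-free, frame-palindromic class with even exponent. -/
theorem credited_of_extremal (b : ℕ → ℤ) {p : ℕ} [hp : Fact p.Prime] (hb : InPolytope b) (hp5 : 5 ≤ p) (hpb : (p : ℤ) ≤ b 0)
    (hwin : (b 0 + 2 : ℤ) < (p : ℤ) ^ 2) {x : ℕ} (hx : x < p) (hc2 : 2 ≤ classPoleCount b p x)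
    (hE : classExp b p x = -(pairFloors b p + 1)) : Credited b p x := by
  have hprime := hp.out
  have hp0 : 0 < p := hprime.pos
  have h0 : 0 ≤ b 0 := hb.1.1
  have hb0 : (((b 0).toNat : ℕ) : ℤ) = b 0 := Int.toNat_of_nonneg h0
  have hodd : ¬ 2 ∣ p := by
    intro h2
    have := (Nat.prime_dvd_prime_iff_eq Nat.prime_two hprime).1 h2
    omega
  obtain ⟨_, hconj, hshape⟩ := classExpRigidity_holds b p x hb hp5 hodd hpb hwin hx hc2 hE
  refine ⟨fun h => by omega, fun hc => hconj (conjClass_eq_self_of_centreIn b h0 hx (by omega) hc), ?_, ?_⟩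
  · intro s hs
    have hmem := (palTau_class b hp0 hx hs).1
    rcases hshape with ⟨_, hall⟩ | ⟨_, hall⟩
    · rw [hall s hs, hall _ hmem]
    · rw [hall s hs, hall _ hmem]
  · rcases hshape with ⟨hN, _⟩ | ⟨hN, _⟩
    · rw [hE, hN]; exact ⟨-1, by norm_num⟩
    · rw [hE, hN]; exact ⟨-2, by norm_num⟩

/-- `ν_x ≤ ν⁺_x`. -/
theorem classNu_le_classNuPlus (b : ℕ → ℤ) (p x : ℕ) : classNu b p x ≤ classNuPlus b p x := by
  unfold classNuPlus; rw [orbitCredit_eq]; split_ifs <;> omega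

/-- **The orbit floor holds**: `VB⁺(b,p) ≥ −N_p(b)` for every window prime `5 ≤ p ≤ b₀ < p² − 2`. -/
theorem orbitFloor_holds : OrbitFloor := by
  intro b p v hb hprime hp5 hpb hwin hv
  haveI : Fact p.Prime := ⟨hprime⟩
  -- `v` is the `ν⁺` of some pole class
  have hvmem := List.min?_mem hv
  obtain ⟨y, hy, hyv⟩ := List.mem_map.1 hvmem
  obtain ⟨hyr, hpole⟩ := List.mem_filter.1 hy
  have hy' : y < p := List.mem_range.1 hyr
  have hpole' : 1 ≤ classPoleCount b p y := by simpa using hpole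
  rw [← hyv]
  by_cases hext : 2 ≤ classPoleCount b p y ∧ classExp b p y = -(pairFloors b p + 1)
  · have hC := credited_of_extremal b hb hp5 hpb hwin hy' hext.1 hext.2
    have hcr : orbitCredit b p y = 1 := by rw [orbitCredit_eq, if_pos hC]
    have hn : classNu b p y = classExp b p y := by unfold classNu; rw [if_neg hC.1]
    unfold classNuPlus; rw [hcr, hn, hext.2]; omega
  · exact (neg_pairFloors_le_classNu b hb hp5 hwin hy' hpole' hext).trans (classNu_le_classNuPlus b p y)

/-! ### Revision (author's seat file v3, `HOME/denom-law/code/d3g4/lean/OrbitCredit.lean` sha256 b056c604…, 2026-08-23T08:26Z): the H* predicate AS STATED, and the H* increment reduced to two class-level layers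

`HasLoopAndPair` above transcribes the author's v1 slip ("`b₀ − b_j − b_k ≥ p` for EVERY `k ≠ j`"); the H* unit of SYMMETRY-D3 §8.7
(`DenomLaw.RuleR`-style `LoopAndPair`, `coblaw.loop_and_pair` of the sealed words) asks for SOME `k ≠ j`.  Append-only discipline (the
first version of this file, p358010, is in the tree): the old predicate is kept and DEPRECATED in favour of `LoopAndPair`; `OrbitFloorH`
(stated with the old, stronger hypothesis, hence a weaker conjecture implied by `OrbitFloorHStar`) is deprecated in favour of `OrbitFloorHStar`.
Everything below is the seat file v3 with these two renamings; filed by the prover seat denom-engine-d2 g4 for the planner seat denom-theory-d3 g4.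

DATA behind the layers (d3g4 `hanat.py` / `hanat_exh.py` / `hsplit_check.py`, exact integer computation, MODEL side): under LoopAndPair no class
with two poles is extremal (0 of 1,352,075 multipole classes of random window cells; exhaustive `p = 5, 7`), and in the first period the non-tame pole
classes AT the floor `E_x = −N_p` have exactly the shapes `(−1,−1)` with `N = 2`, `(−2,−2)` with `N = 4`, `(0,−6,0)` with `N = 6` — all centre-free,
frame-palindromic, even: CREDITED (0 exceptions in 30,001 random + 16,875 exhaustive first-period H-cells); PAPER derivation: SYMMETRY-D3 §9.9. -/

/-- LoopAndPair — the `H` predicate of the H* unit AS STATED (SYMMETRY-D3 §8.7; `coblaw.loop_and_pair`): some vertex `j` carries a large LOOP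
(`b_j ≥ p`) AND a large PAIR (`b₀ − b_j − b_k ≥ p` for SOME `k ≠ j`).  Supersedes `HasLoopAndPair`. -/
def LoopAndPair (b : ℕ → ℤ) (p : ℕ) : Prop :=
  ∃ j ∈ Finset.Icc 1 7, (p : ℤ) ≤ b j ∧ ∃ k ∈ Finset.Icc 1 7, k ≠ j ∧ (p : ℤ) ≤ b 0 - b j - b k

/-- `LoopAndPair` is decidable. -/
instance (b : ℕ → ℤ) (p : ℕ) : Decidable (LoopAndPair b p) := by
  unfold LoopAndPair; infer_instance

attribute [deprecated LoopAndPair (since := "2026-08-23")] HasLoopAndPair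

/-- **ORBIT FLOOR UNDER H, AS STATED (CONJECTURED, digit-free; with `ClassOrbitBound` it gives the H* unit (VH))**: in the first period of the
one-carry regime, `LoopAndPair` lifts the orbit floor by one.  Supersedes `OrbitFloorH` (same statement with the mis-transcribed predicate). -/
@[conjecture] def OrbitFloorHStar : Prop :=
  ∀ (b : ℕ → ℤ) (p : ℕ) (v : ℤ), InPolytope b → p.Prime → 5 ≤ p → (p : ℤ) ≤ b 0 → (b 0 + 2 : ℤ) < (p : ℤ) ^ 2 →
    (p : ℤ) ≤ dOf b → dOf b < 2 * (p : ℤ) → mOne b < 2 * (p : ℤ) → LoopAndPair b p →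
      vbPlus b p = some v → -pairFloors b p + 1 ≤ v

attribute [deprecated OrbitFloorHStar (since := "2026-08-23")] OrbitFloorH
/-- A large pair at a vertex gives `N_p ≥ 1`. -/
theorem one_le_pairFloors_of_loopAndPair (b : ℕ → ℤ) (hb : InPolytope b) {p : ℕ} (hp : 0 < p) (hH : LoopAndPair b p) :
    1 ≤ pairFloors b p := by
  obtain ⟨j, hj, _, k, hk, hkj, hpair⟩ := hH
  rw [Finset.mem_Icc] at hj hk
  have hstar := sum_pairs_through_le b hb p (i₀ := k - 1) (mem_range.2 (by omega))
  have hterm : 1 ≤ pairTerm b p (min (j - 1) (k - 1)) (max (j - 1) (k - 1)) := by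
    have hp' : (0 : ℤ) < (p : ℤ) := by exact_mod_cast hp
    rcases Nat.lt_or_gt_of_ne hkj with h | h
    · rw [min_eq_right (by omega), max_eq_left (by omega)]
      unfold pairTerm
      rw [show k - 1 + 1 = k by omega, show j - 1 + 1 = j by omega]
      exact Int.le_ediv_of_mul_le hp' (by linarith)
    · rw [min_eq_left (by omega), max_eq_right (by omega)]
      unfold pairTerm
      rw [show k - 1 + 1 = k by omega, show j - 1 + 1 = j by omega]
      exact Int.le_ediv_of_mul_le hp' (by linarith)
  have hle : pairTerm b p (min (j - 1) (k - 1)) (max (j - 1) (k - 1)) ≤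
      ∑ i ∈ (range 7).erase (k - 1), pairTerm b p (min i (k - 1)) (max i (k - 1)) := by
    refine single_le_sum (f := fun i => pairTerm b p (min i (k - 1)) (max i (k - 1))) (fun i hi => ?_)
      (mem_erase.2 ⟨by omega, mem_range.2 (by omega)⟩)
    have hi7 := mem_range.1 (mem_erase.1 hi).2
    exact pairTerm_nonneg b hb p (by omega) (by omega)
  linarith

/-- **LAYER 1 (CONJECTURED; paper proof SYMMETRY-D3 §9.9, stated for the whole window)**: under LoopAndPair NO class is extremal —
`E_x = −(N_p+1)` with two poles would force (`classExpRigidity_holds`) the shapes `(−1,−1)`, `N = 1` / `(−2,−2)`, `N = 3` whose large pairs all pass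
through blocks `B_j` with `b_j ≤ x < p`, leaving no room for a large loop on a large pair. -/
@[conjecture] def NoExtremalUnderH : Prop :=
  ∀ (b : ℕ → ℤ) (p x : ℕ), InPolytope b → p.Prime → 5 ≤ p → (p : ℤ) ≤ b 0 → (b 0 + 2 : ℤ) < (p : ℤ) ^ 2 →
    LoopAndPair b p → x < p → 2 ≤ classPoleCount b p x → classExp b p x ≠ -(pairFloors b p + 1)

/-- **LAYER 2 (CONJECTURED)**: in the first period of the one-carry regime, under LoopAndPair, a NON-TAME pole class at the floor
`E_x = −N_p` is credited (centre-free, frame-palindromic, even exponent).  Observed shapes: `(−1,−1)`/`N=2`, `(−2,−2)`/`N=4`, `(0,−6,0)`/`N=6`. -/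
@[conjecture] def FloorLayerCreditedUnderH : Prop :=
  ∀ (b : ℕ → ℤ) (p x : ℕ), InPolytope b → p.Prime → 5 ≤ p → (p : ℤ) ≤ b 0 → (b 0 + 2 : ℤ) < (p : ℤ) ^ 2 →
    (p : ℤ) ≤ dOf b → dOf b < 2 * (p : ℤ) → mOne b < 2 * (p : ℤ) → LoopAndPair b p → x < p →
      1 ≤ classPoleCount b p x → ¬ (classPoleCount b p x = 1 ∧ tameSingle b p x = true) →
        classExp b p x = -pairFloors b p → Credited b p x

/-- **`OrbitFloorH` follows from the two layers** (with `neg_pairFloors_le_classNu` for everything off the floor and `N_p ≥ 1` for tame classes). -/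
theorem orbitFloorHStar_of_layers (h1 : NoExtremalUnderH) (h2 : FloorLayerCreditedUnderH) : OrbitFloorHStar := by
  intro b p v hb hprime hp5 hpb hwin hd1 hd2 hm1 hH hv
  haveI : Fact p.Prime := ⟨hprime⟩
  have hp0 : 0 < p := hprime.pos
  have hN1 := one_le_pairFloors_of_loopAndPair b hb hp0 hH
  have hvmem := List.min?_mem hv
  obtain ⟨y, hy, hyv⟩ := List.mem_map.1 hvmem
  obtain ⟨hyr, hpole⟩ := List.mem_filter.1 hy
  have hy' : y < p := List.mem_range.1 hyr
  have hpole' : 1 ≤ classPoleCount b p y := by simpa using hpole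
  rw [← hyv]
  have hnot : ¬ (2 ≤ classPoleCount b p y ∧ classExp b p y = -(pairFloors b p + 1)) :=
    fun h => h1 b p y hb hprime hp5 hpb hwin hH hy' h.1 h.2
  have hnu := neg_pairFloors_le_classNu b hb hp5 hwin hy' hpole' hnot
  have hle := classNu_le_classNuPlus b p y
  by_cases htame : classPoleCount b p y = 1 ∧ tameSingle b p y = true
  · have h0 : 0 ≤ classNu b p y := by unfold classNu; rw [if_pos htame]; exact le_max_right _ _
    omega
  · have hn : classNu b p y = classExp b p y := by unfold classNu; rw [if_neg htame]
    by_cases hE : classExp b p y = -pairFloors b p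
    · have hC := h2 b p y hb hprime hp5 hpb hwin hd1 hd2 hm1 hH hy' hpole' htame hE
      have hcr : orbitCredit b p y = 1 := by rw [orbitCredit_eq, if_pos hC]
      unfold classNuPlus; rw [hcr, hn, hE]
    · have : -pairFloors b p + 1 ≤ classNu b p y := by rw [hn] at hnu ⊢; omega
      omega

end Summit.KontsevichZagierPeriods.Zeta5Search.ClusterValuation.Orbit
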